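import Summits.Ventures.HSemireg.Pad4TowerLinePhaseRigidityModel

/-!
# Pad4Tower ∕ LinePhaseRigidity — Part E THE CEILING GAP LAW and Part F THE FULL (SHARP) CEILING GAP LAW `g_P = 3`, `g_N = 4` (h-uniform, PROVED in the abstract LINE model, hence for every `G₁`-closed RULE-D∕`X+` LINE design): a fully charged `P`-cell keeps three levels below the ceiling, a fully charged `N`-cell four
# (HSemireg support file; PT-PORT-2 (a2), tree copy of control's crux workfile)

Crux of record: `Summit.HodgeConjecture.HodgeConjecture.Theses.EightfoldBlochSeeds.BlochSeedDiscOne` (= `HasHyperbolicBlochSeed 4 1`, item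
stmt-HodgeConjecture-18881; skeleton `Cruxes/BlochSeedDiscOne/Lines/birth.lean` 814a6a70c14e831a, STUB R `stub_rung_pad4_seedAt`, UNTOUCHED).
Nothing in this file proves HC, HC_AV, HC_CM, H2, item 18881, (T₈) or (T₁₀); census-neutral (no SAT∕UNSAT row is added or changed). Statements about
the typed FIRST-ORDER static game on the LINE alphabet of the PAD-4 design tower (`RuleDMu4Closed`, `XPlusClosed`, `G1Closed` of record) — H₁-static
letter DESIGNS, not sheaves, monads or seeds; HC_CM is a displayed binder of the ladder only, unused here.

PROVENANCE. TREE COPY — statements AND proofs verbatim; new are only the namespace `Summit.Ventures.HSemireg.Pad4Tower.LinePhaseRigidity`, this module docstring, the module boundary, the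
`import`∕`open` of the tree toolkit `Pad4TowerLineInertiaLetters`∕`…XPlus` (namespace `…Pad4Tower.LineInertia`, = the workfile's Part A + §C1, landed
separately under the same key) and one-line docstrings where the gate requires them — of Part E and Part F of the crux workfile `Cruxes/BlochSeedDiscOne/LinePhaseRigidity.lean` v1.9 (author plan-lens-HodgeAV-control g9; crux commit f5c30e1c3066, sha16 f0ad6d2122a71d9c; critic plates idea-crit-6 g15 PASS). Filed in the tree on plan-lens-HodgeAV-control
g10's KEY (a2) (bus l.10147: «LinePhaseRigidity Parts B–F → tree, so that `DiamondLevelLaws.LineFloorDepth h` (∀ h) is a tree theorem») by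
hsemireg-phasetorus-typer-1 g3. Module set of (a2): `Pad4TowerLinePhaseRigidityUnits` (Parts B, C) → `Pad4TowerLinePhaseRigidityModel` (Part D) →
`Pad4TowerLinePhaseRigidityGap` (Parts E, F). 0 sorry, 0 named facts, no instance ∕ notation ∕ set_option ∕ native_decide; docstring on every declaration.

CONTENT. Part E: `fin4_others`; in `namespace LineModel`: the served-cell gaps from `rdP`∕`rdN2` alone (`n_two_charged_gap`, …, `fcP_gap_two`, `fcN_gap_three`),
`abstractOddFree_of_nucleus`. Part F: **`n_ceiling_absent`** (a lone ceiling letter cannot sit on the `N` level — uses `X+`), the chain one level higher up to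
**`fcP_gap_three`** (`2(c+3) ≤ h`) and **`fcN_gap_four`** (`2(c+4) ≤ h`) = the machine gaps of `DEPTH-G1-h8-18.txt`; corollaries for every `h`: `abstractOddFree_of_sharpNucleus`,
no FC cell below `h = 8`, no FC `N`-cell below `h = 10`, `OddFCFreeLine h` for every `h < 8` — the statements `DiamondLevelLaws.LineFloorDepth` displays.
-/

namespace Summit.Ventures.HSemireg.Pad4Tower.LinePhaseRigidity

open Finset Summit.Ventures.HSemireg.Pad4Tower Summit.Ventures.HSemireg.LinePhaseTorus Summit.Ventures.HSemireg.Pad4Tower.LineInertia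

/-! ## Part E — the CEILING GAP LAW (h-uniform; PROVED in the abstract model, hence for every `G₁`-closed RULE-D∕`X+` LINE design)

The controlling quantity this exposes is the HEIGHT OF A CELL'S TALLEST LETTER (its maximal charge `m`): served cells keep a gap
below the ceiling `n = h∕2` that grows with the number of charged letters and by one from `P` to `N` (RD-N raises a charge, RD-P
lowers one).  PROVED here, uniformly in `h`, from `rdP`∕`rdN2` alone: an `N`-cell with two charged letters has all charges `≤ n−1`,
a `P`-cell with three charged letters has charges `≤ n−1`, an `N`-cell with three charged letters `≤ n−2`, a fully charged `P`-cell
`≤ n−2`, a fully charged `N`-cell `≤ n−3`.  MACHINE (`odd/depth.py`, `DEPTH-G1-h8-18.txt` c6067236872d0c33; phase-blind, h = 8…18):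
the true gaps are one larger — FC `P`: `m ≤ n−3`, FC `N`: `m ≤ n−4` (depth `n, n−1` die by unit propagation, `n−2` by 17–31
conflicts) — and refine by phase type (`TGRID-G1-h16-P.txt`: gap 3 for types `000x`, 4 for `0011∕0022∕0012∕0013∕0023`, 6 for `0123`).
Consequence (PROVED): the finite odd-freeness check reduces to its BOTTOM NUCLEUS (`abstractOddFree_of_nucleus`). -/

/-- three further slots of `Fin 4`, pairwise distinct. -/
theorem fin4_others (g : Fin 4) : g + 1 ≠ g ∧ g + 2 ≠ g ∧ g + 3 ≠ g ∧ g + 1 ≠ g + 2 ∧ g + 1 ≠ g + 3 ∧ g + 2 ≠ g + 3 := by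
  revert g; decide

namespace LineModel

variable {h : ℤ} {vN vP : ACell → Prop}

/-- **(E1)** an `N`-cell with two charged slots has each of them strictly below the ceiling: `2(c+1) ≤ h`. -/
theorem n_gap_one (M : LineModel h vN vP) {X : ACell} (hX : vN X) {g j : Fin 4} (hgj : g ≠ j)
    (hg : 1 ≤ (X g).1) (hj : 1 ≤ (X j).1) : 2 * ((X g).1 : ℤ) + 2 ≤ h := by
  obtain ⟨c', hc', hch, -⟩ := M.rdN2 X hX g j hgj hg hj
  have : ((X g).1 : ℤ) + 1 ≤ c' := by exact_mod_cast hc'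
  linarith

/-- **(E2)** a `P`-cell with three charged slots has each of them strictly below the ceiling (RD-P at a second slot lands on an
`N`-cell that still has two charged slots). -/
theorem p_gap_one (M : LineModel h vN vP) {X : ACell} (hX : vP X) {g f j : Fin 4} (hgf : g ≠ f) (hgj : g ≠ j) (hfj : f ≠ j)
    (hg : 1 ≤ (X g).1) (hf : 1 ≤ (X f).1) (hj : 1 ≤ (X j).1) : 2 * ((X g).1 : ℤ) + 2 ≤ h := by
  obtain ⟨c', -, hN⟩ := M.rdP X hX f hf
  have eg : Function.update X f (c', (X f).2) g = X g := Function.update_of_ne hgf _ _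
  have ej : Function.update X f (c', (X f).2) j = X j := Function.update_of_ne hfj.symm _ _
  have key := M.n_gap_one hN (g := g) (j := j) hgj (by rw [eg]; exact hg) (by rw [ej]; exact hj)
  rwa [eg] at key

/-- **(E3)** an `N`-cell with three charged slots keeps TWO levels below the ceiling: `2(c+2) ≤ h`. -/
theorem n_gap_two (M : LineModel h vN vP) {X : ACell} (hX : vN X) {g f j : Fin 4} (hgf : g ≠ f) (hgj : g ≠ j) (hfj : f ≠ j)
    (hg : 1 ≤ (X g).1) (hf : 1 ≤ (X f).1) (hj : 1 ≤ (X j).1) : 2 * ((X g).1 : ℤ) + 4 ≤ h := by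
  obtain ⟨c', hc', -, hP⟩ := M.rdN2 X hX g j hgj hg hj
  have eg : Function.update X g (c', (X g).2) g = (c', (X g).2) := Function.update_self _ _ _
  have ef : Function.update X g (c', (X g).2) f = X f := Function.update_of_ne hgf.symm _ _
  have ej : Function.update X g (c', (X g).2) j = X j := Function.update_of_ne hgj.symm _ _
  have key := M.p_gap_one hP (g := g) (f := f) (j := j) hgf hgj hfj (by rw [eg]; omega) (by rw [ef]; exact hf)
    (by rw [ej]; exact hj)
  rw [eg] at key
  have : ((X g).1 : ℤ) + 1 ≤ c' := by exact_mod_cast hc'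
  push_cast at key
  linarith

/-- **(E4) fully charged `P`-cells keep two levels below the ceiling**: every charge satisfies `2(c+2) ≤ h`. -/
theorem fcP_gap (M : LineModel h vN vP) {X : ACell} (hX : vP X) (hc : ∀ f, 1 ≤ (X f).1) (g : Fin 4) :
    2 * ((X g).1 : ℤ) + 4 ≤ h := by
  obtain ⟨h1, h2, h3, h12, h13, h23⟩ := fin4_others g
  obtain ⟨c', -, hN⟩ := M.rdP X hX (g + 1) (hc (g + 1))
  have eg : Function.update X (g + 1) (c', (X (g + 1)).2) g = X g := Function.update_of_ne h1.symm _ _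
  have e2 : Function.update X (g + 1) (c', (X (g + 1)).2) (g + 2) = X (g + 2) := Function.update_of_ne h12.symm _ _
  have e3 : Function.update X (g + 1) (c', (X (g + 1)).2) (g + 3) = X (g + 3) := Function.update_of_ne h13.symm _ _
  have key := M.n_gap_two hN (g := g) (f := g + 2) (j := g + 3) h2.symm h3.symm h23 (by rw [eg]; exact hc g)
    (by rw [e2]; exact hc (g + 2)) (by rw [e3]; exact hc (g + 3))
  rwa [eg] at key

/-- **(E5) fully charged `N`-cells keep three levels below the ceiling**: every charge satisfies `2(c+3) ≤ h`. -/
theorem fcN_gap (M : LineModel h vN vP) {X : ACell} (hX : vN X) (hc : ∀ f, 1 ≤ (X f).1) (g : Fin 4) :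
    2 * ((X g).1 : ℤ) + 6 ≤ h := by
  obtain ⟨h1, -, -, -, -, -⟩ := fin4_others g
  obtain ⟨c', hc', -, hP⟩ := M.rdN2 X hX g (g + 1) h1.symm (hc g) (hc (g + 1))
  have hcZ : ∀ f, 1 ≤ (Function.update X g (c', (X g).2) f).1 := by
    intro f
    by_cases hf : f = g
    · subst hf; rw [Function.update_self]; exact le_of_lt (lt_of_le_of_lt (hc f) hc')
    · rw [Function.update_of_ne hf]; exact hc f
  have key := M.fcP_gap hP hcZ g
  rw [Function.update_self] at key
  have : ((X g).1 : ℤ) + 1 ≤ c' := by exact_mod_cast hc'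
  push_cast at key
  linarith

/-- presence DESCENDS FROM `N` TO `P` WITH THE PHASE TAGS UNCHANGED (RD-N raises one charge and keeps its tag): for any tag word `w`,
if no fully charged `P`-cell with tags `w` is present then no fully charged `N`-cell with tags `w` is present — the PROVED half
(`t_P(T) ≤ t_N(T)`) of the machine law `t_N(T) = t_P(T) + 2`. -/
theorem fcN_absent_of_fcP_absent (M : LineModel h vN vP) (w : Fin 4 → Fin 4)
    (hP : ∀ X : ACell, (∀ f, 1 ≤ (X f).1) → (∀ f, (X f).2 = w f) → ¬ vP X) :
    ∀ X : ACell, (∀ f, 1 ≤ (X f).1) → (∀ f, (X f).2 = w f) → ¬ vN X := by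
  intro X hc hw hX
  have h01 : (0 : Fin 4) ≠ 1 := by decide
  obtain ⟨c', hc', -, hPX⟩ := M.rdN2 X hX 0 1 h01 (hc 0) (hc 1)
  refine hP _ (fun f => ?_) (fun f => ?_) hPX
  · by_cases hf : f = 0
    · subst hf; rw [Function.update_self]; exact le_of_lt (lt_of_le_of_lt (hc _) hc')
    · rw [Function.update_of_ne hf]; exact hc f
  · by_cases hf : f = 0
    · subst hf; rw [Function.update_self]; exact hw _
    · rw [Function.update_of_ne hf]; exact hw f

end LineModel

/-- **the CEILING GAP LAW for LINE designs, `P` level** (PROVED, every `h`): a fully charged RULE-D `P`-cell of a `G₁`-closed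
RULE-D∕`X+` design on effective LINE-`h` letters has every letter of charge `c` with `2(c+2) ≤ h`. -/
theorem fc_ceiling_gap_P {h : ℤ} {C : MConfig} (hC : LSupport h C) (hG : C.G1Closed) (hD : RuleDMu4Closed C)
    (hX : XPlusClosed C) {P : MCell} (hP : P ∈ C.upper) (hFC : FCc P) {f : Fin 4} {c : ℕ} {k : Fin 4}
    (e : P f = lineLetter h c k) : 2 * (c : ℤ) + 4 ≤ h := by
  have hM := lineModel_of_config hC hG hD hX
  obtain ⟨X, rfl⟩ := exists_realize (fun g => hC.2 _ hP g)
  have hc := charges_pos_of_fcc hFC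
  rw [realize_apply] at e
  rw [← charge_eq_of_lineLetter_eq e]
  exact hM.fcP_gap hP hc f

/-- **the CEILING GAP LAW for LINE designs, `N` level** (PROVED, every `h`): `2(c+3) ≤ h` for every letter of a fully charged `N`-cell. -/
theorem fc_ceiling_gap_N {h : ℤ} {C : MConfig} (hC : LSupport h C) (hG : C.G1Closed) (hD : RuleDMu4Closed C)
    (hX : XPlusClosed C) {N : MCell} (hN : N ∈ C.lower) (hFC : FCc N) {f : Fin 4} {c : ℕ} {k : Fin 4}
    (e : N f = lineLetter h c k) : 2 * (c : ℤ) + 6 ≤ h := by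
  have hM := lineModel_of_config hC hG hD hX
  obtain ⟨X, rfl⟩ := exists_realize (fun g => hC.1 _ hN g)
  have hc := charges_pos_of_fcc hFC
  rw [realize_apply] at e
  rw [← charge_eq_of_lineLetter_eq e]
  exact hM.fcN_gap hN hc f

/-- in particular (PROVED, every `h`): no fully charged `P`-cell below `h = 6`, no fully charged `N`-cell below `h = 8` —
the FC thresholds of the census (`fc_threshold`: none at LINE-6 … ) from the `P`∕`N` gap alone, uniformly. -/
theorem no_fcP_below_six {h : ℤ} (hh : h < 6) {C : MConfig} (hC : LSupport h C) (hG : C.G1Closed) (hD : RuleDMu4Closed C)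
    (hX : XPlusClosed C) {P : MCell} (hP : P ∈ C.upper) : ¬ FCc P := by
  intro hFC
  obtain ⟨X, rfl⟩ := exists_realize (fun g => hC.2 _ hP g)
  have hc := charges_pos_of_fcc hFC
  have key := (lineModel_of_config hC hG hD hX).fcP_gap hP hc 0
  have : (1 : ℤ) ≤ (X 0).1 := by exact_mod_cast hc 0
  linarith

/-- `no_fcN_below_eight` (Part E; tree copy, statement verbatim). -/
theorem no_fcN_below_eight {h : ℤ} (hh : h < 8) {C : MConfig} (hC : LSupport h C) (hG : C.G1Closed) (hD : RuleDMu4Closed C)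
    (hX : XPlusClosed C) {N : MCell} (hN : N ∈ C.lower) : ¬ FCc N := by
  intro hFC
  obtain ⟨X, rfl⟩ := exists_realize (fun g => hC.1 _ hN g)
  have hc := charges_pos_of_fcc hFC
  have key := (lineModel_of_config hC hG hD hX).fcN_gap hN hc 0
  have : (1 : ℤ) ≤ (X 0).1 := by exact_mod_cast hc 0
  linarith

/-- **the BOTTOM NUCLEUS of the odd-freeness check**: only odd cells inside the proved gaps need checking. -/
def AbstractOddNucleusFree (h : ℤ) : Prop :=
  ∀ vN vP : ACell → Prop, LineModel h vN vP → ∀ X : ACell, AOddFC X →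
    ((∀ f, 2 * ((X f).1 : ℤ) + 6 ≤ h) → ¬ vN X) ∧ ((∀ f, 2 * ((X f).1 : ℤ) + 4 ≤ h) → ¬ vP X)

/-- REDUCTION (PROVED): the nucleus check implies the full check. -/
theorem abstractOddFree_of_nucleus {h : ℤ} (hN : AbstractOddNucleusFree h) : AbstractOddFree h := by
  intro vN vP M X hX
  refine ⟨fun hv => (hN vN vP M X hX).1 (fun f => M.fcN_gap hv hX.1 f) hv,
    fun hv => (hN vN vP M X hX).2 (fun f => M.fcP_gap hv hX.1 f) hv⟩

/-- so (PROVED) odd-freeness of every LINE design of height `< 6` is unconditional, and `OddLineThresholdLaw` needs the machine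
check only on the nucleus at `h = 10` (cells with all charges `≤ 3` on `P`, `≤ 2` on `N`). -/
theorem oddFCFreeLine_of_lt_six {h : ℤ} (hh : h < 6) : OddFCFreeLine h := by
  intro C hC hG hD hX hodd
  rcases hodd with ⟨Z, hZ, hFC, -⟩ | ⟨P, hP, hFC, -⟩
  · exact no_fcN_below_eight (by omega) hC hG hD hX hZ hFC
  · exact no_fcP_below_six hh hC hG hD hX hP hFC


/-! ## Part F — the FULL CEILING GAP LAW (h-uniform, PROVED): `g_P = 3`, `g_N = 4` — kernel = machine for the phase-blind part

The missing unit of Part E comes from ONE new lemma that uses `X+`: **a lone ceiling letter cannot sit on the `N` level**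
(`n_ceiling_absent`: RD-N1 serves such a cell by `P`-cells `(d,p)@j` avoiding ANY prescribed tag, hence by two of different
tags on the same slot; both share the hub and have no companions (two charged letters next to a ceiling letter violate (E1)),
so `X+` fires).  From it the chain of Part E restarts one level higher: `P` with a ceiling letter and another charged letter is
absent, `N` with two charged letters keeps two levels, `P` with three charged keeps two, `N` with three charged keeps three,
FC `P` keeps THREE (`2(c+3) ≤ h`), FC `N` keeps FOUR (`2(c+4) ≤ h`) — exactly the machine gaps of `DEPTH-G1-h8-18.txt`.
Corollaries (PROVED, every h): no FC cell at all below `h = 8` (the census∕`LineInertia.fc_threshold` lower half, now for all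
`h < 8` at once and from the four closed forms alone), no FC `N`-cell below `h = 10`, `OddFCFreeLine h` for every `h < 8`. -/

namespace LineModel

variable {h : ℤ} {vN vP : ACell → Prop}

/-- **(U) no `N`-cell carries a ceiling letter** (`2(c+1) > h`): with a second charged letter this is (E1); alone, RD-N1 + `X+`. -/
theorem n_ceiling_absent (M : LineModel h vN vP) {X : ACell} (hX : vN X) (g : Fin 4) (hg : 1 ≤ (X g).1)
    (hc : h < 2 * ((X g).1 : ℤ) + 2) : False := by
  obtain ⟨h1, h2, -, h12, -, -⟩ := fin4_others g
  have hap : ∀ j, j ≠ g → (X j).1 = 0 := by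
    intro j hj
    by_contra hne
    have key := M.n_gap_one hX (g := g) (j := j) (Ne.symm hj) hg (Nat.one_le_iff_ne_zero.mpr hne)
    linarith
  have hnoN : ∀ (c' : ℕ) (p : Fin 4), 1 ≤ c' → ¬ vN (Function.update X (g + 1) (c', p)) := by
    intro c' p hc' hv
    have e1 : Function.update X (g + 1) (c', p) g = X g := Function.update_of_ne h1.symm _ _
    have e2 : Function.update X (g + 1) (c', p) (g + 1) = (c', p) := Function.update_self _ _ _
    have key := M.n_gap_one hv (g := g) (j := g + 1) h1.symm (by rw [e1]; exact hg) (by rw [e2]; exact hc')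
    rw [e1] at key
    linarith
  have key : ∀ k' : Fin 4, ∃ d : ℕ, ∃ p : Fin 4, 1 ≤ d ∧ p ≠ k' ∧ vP (Function.update X (g + 1) (d, p)) := by
    intro k'
    rcases M.rdN1 X hX g (g + 1) h1.symm hg (hap _ h1) k' with
      ⟨c', hc', hch, -⟩ | ⟨d, p, hd, hp, hv⟩ | ⟨c', d, p, hc', hch, -, -, -⟩
    · exfalso
      have : ((X g).1 : ℤ) + 1 ≤ c' := by exact_mod_cast hc'
      linarith
    · exact ⟨d, p, hd, hp, hv⟩
    · exfalso
      have : ((X g).1 : ℤ) + 1 ≤ c' := by exact_mod_cast hc'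
      linarith
  obtain ⟨d₀, p₀, hd₀, -, hv₀⟩ := key 0
  obtain ⟨d₁, p₁, hd₁, hp₁, hv₁⟩ := key p₀
  have eσ : Function.update X (g + 1) (d₀, p₀) (g + 1) = (d₀, p₀) := Function.update_self _ _ _
  have ef : Function.update X (g + 1) (d₀, p₀) (g + 2) = X (g + 2) := Function.update_of_ne h12.symm _ _
  refine M.xplus (Function.update X (g + 1) (d₀, p₀)) hv₀ (g + 1) (g + 2) h12.symm (by rw [eσ]; exact hd₀)
    (by rw [ef]; exact hap _ h2) ?_ ?_ d₁ p₁ (by rw [eσ]; exact hp₁) hd₁ ?_ ?_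
  · rw [Function.update_idem]; exact M.apexN X hX (g + 1) 0 (hap _ h1)
  · intro c' hc' _
    rw [eσ, Function.update_idem]
    exact hnoN c' p₀ hc'
  · rw [Function.update_idem]; exact hv₁
  · intro e' he' _
    rw [Function.update_idem]
    exact hnoN e' p₁ he'

/-- **(PC) no `P`-cell carries a ceiling letter next to another charged letter** (RD-P at the other letter lands on (U)). -/
theorem p_ceiling_absent (M : LineModel h vN vP) {X : ACell} (hX : vP X) {g b : Fin 4} (hgb : g ≠ b)
    (hg : 1 ≤ (X g).1) (hb : 1 ≤ (X b).1) (hc : h < 2 * ((X g).1 : ℤ) + 2) : False := by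
  obtain ⟨c', -, hN⟩ := M.rdP X hX b hb
  have e : Function.update X b (c', (X b).2) g = X g := Function.update_of_ne hgb _ _
  exact M.n_ceiling_absent hN g (by rw [e]; exact hg) (by rw [e]; exact hc)

/-- (E1′) an `N`-cell with two charged slots keeps TWO levels below the ceiling. -/
theorem n2_gap_two (M : LineModel h vN vP) {X : ACell} (hX : vN X) {g j : Fin 4} (hgj : g ≠ j)
    (hg : 1 ≤ (X g).1) (hj : 1 ≤ (X j).1) : 2 * ((X g).1 : ℤ) + 4 ≤ h := by
  by_contra hlt
  push Not at hlt
  obtain ⟨c', hc', -, hP⟩ := M.rdN2 X hX g j hgj hg hj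
  have eg : Function.update X g (c', (X g).2) g = (c', (X g).2) := Function.update_self _ _ _
  have ej : Function.update X g (c', (X g).2) j = X j := Function.update_of_ne hgj.symm _ _
  have : ((X g).1 : ℤ) + 1 ≤ c' := by exact_mod_cast hc'
  exact M.p_ceiling_absent hP (g := g) (b := j) hgj (by rw [eg]; omega) (by rw [ej]; exact hj)
    (by rw [eg]; push_cast; linarith)

/-- (E2′) a `P`-cell with three charged slots keeps two levels below the ceiling. -/
theorem p3_gap_two (M : LineModel h vN vP) {X : ACell} (hX : vP X) {g a b : Fin 4} (hga : g ≠ a) (hgb : g ≠ b)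
    (hab : a ≠ b) (hg : 1 ≤ (X g).1) (ha : 1 ≤ (X a).1) (hb : 1 ≤ (X b).1) : 2 * ((X g).1 : ℤ) + 4 ≤ h := by
  obtain ⟨c', -, hN⟩ := M.rdP X hX a ha
  have eg : Function.update X a (c', (X a).2) g = X g := Function.update_of_ne hga _ _
  have eb : Function.update X a (c', (X a).2) b = X b := Function.update_of_ne hab.symm _ _
  have key := M.n2_gap_two hN (g := g) (j := b) hgb (by rw [eg]; exact hg) (by rw [eb]; exact hb)
  rwa [eg] at key

/-- (E3′) an `N`-cell with three charged slots keeps THREE levels below the ceiling. -/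
theorem n3_gap_three (M : LineModel h vN vP) {X : ACell} (hX : vN X) {g a b : Fin 4} (hga : g ≠ a) (hgb : g ≠ b)
    (hab : a ≠ b) (hg : 1 ≤ (X g).1) (ha : 1 ≤ (X a).1) (hb : 1 ≤ (X b).1) : 2 * ((X g).1 : ℤ) + 6 ≤ h := by
  obtain ⟨c', hc', -, hP⟩ := M.rdN2 X hX g a hga hg ha
  have eg : Function.update X g (c', (X g).2) g = (c', (X g).2) := Function.update_self _ _ _
  have ea : Function.update X g (c', (X g).2) a = X a := Function.update_of_ne hga.symm _ _
  have eb : Function.update X g (c', (X g).2) b = X b := Function.update_of_ne hgb.symm _ _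
  have key := M.p3_gap_two hP (g := g) (a := a) (b := b) hga hgb hab (by rw [eg]; omega) (by rw [ea]; exact ha)
    (by rw [eb]; exact hb)
  rw [eg] at key
  have : ((X g).1 : ℤ) + 1 ≤ c' := by exact_mod_cast hc'
  push_cast at key
  linarith

/-- **(E4′ = g_P ≥ 3) fully charged `P`-cells keep THREE levels below the ceiling**: `2(c+3) ≤ h` for every charge. -/
theorem fcP_gap_three (M : LineModel h vN vP) {X : ACell} (hX : vP X) (hc : ∀ f, 1 ≤ (X f).1) (g : Fin 4) :
    2 * ((X g).1 : ℤ) + 6 ≤ h := by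
  obtain ⟨h1, h2, h3, h12, h13, h23⟩ := fin4_others g
  obtain ⟨c', -, hN⟩ := M.rdP X hX (g + 1) (hc (g + 1))
  have eg : Function.update X (g + 1) (c', (X (g + 1)).2) g = X g := Function.update_of_ne h1.symm _ _
  have e2 : Function.update X (g + 1) (c', (X (g + 1)).2) (g + 2) = X (g + 2) := Function.update_of_ne h12.symm _ _
  have e3 : Function.update X (g + 1) (c', (X (g + 1)).2) (g + 3) = X (g + 3) := Function.update_of_ne h13.symm _ _
  have key := M.n3_gap_three hN (g := g) (a := g + 2) (b := g + 3) h2.symm h3.symm h23 (by rw [eg]; exact hc g)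
    (by rw [e2]; exact hc (g + 2)) (by rw [e3]; exact hc (g + 3))
  rwa [eg] at key

/-- **(E5′ = g_N ≥ 4) fully charged `N`-cells keep FOUR levels below the ceiling**: `2(c+4) ≤ h` for every charge. -/
theorem fcN_gap_four (M : LineModel h vN vP) {X : ACell} (hX : vN X) (hc : ∀ f, 1 ≤ (X f).1) (g : Fin 4) :
    2 * ((X g).1 : ℤ) + 8 ≤ h := by
  obtain ⟨h1, -, -, -, -, -⟩ := fin4_others g
  obtain ⟨c', hc', -, hP⟩ := M.rdN2 X hX g (g + 1) h1.symm (hc g) (hc (g + 1))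
  have hcZ : ∀ f, 1 ≤ (Function.update X g (c', (X g).2) f).1 := by
    intro f
    by_cases hf : f = g
    · subst hf; rw [Function.update_self]; exact le_of_lt (lt_of_le_of_lt (hc f) hc')
    · rw [Function.update_of_ne hf]; exact hc f
  have key := M.fcP_gap_three hP hcZ g
  rw [Function.update_self] at key
  have : ((X g).1 : ℤ) + 1 ≤ c' := by exact_mod_cast hc'
  push_cast at key
  linarith

end LineModel

/-- **THE CEILING GAP LAW, `P` level, sharp form** (PROVED, every `h`): every letter of a fully charged RULE-D `P`-cell of a
`G₁`-closed RULE-D∕`X+` LINE design has charge `c` with `2(c+3) ≤ h` — the machine gap `g_P = 3` exactly. -/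
theorem fc_ceiling_gap_P_three {h : ℤ} {C : MConfig} (hC : LSupport h C) (hG : C.G1Closed) (hD : RuleDMu4Closed C)
    (hX : XPlusClosed C) {P : MCell} (hP : P ∈ C.upper) (hFC : FCc P) {f : Fin 4} {c : ℕ} {k : Fin 4}
    (e : P f = lineLetter h c k) : 2 * (c : ℤ) + 6 ≤ h := by
  have hM := lineModel_of_config hC hG hD hX
  obtain ⟨X, rfl⟩ := exists_realize (fun g => hC.2 _ hP g)
  have hc := charges_pos_of_fcc hFC
  rw [realize_apply] at e
  rw [← charge_eq_of_lineLetter_eq e]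
  exact hM.fcP_gap_three hP hc f

/-- **THE CEILING GAP LAW, `N` level, sharp form** (PROVED, every `h`): `2(c+4) ≤ h` — the machine gap `g_N = 4` exactly. -/
theorem fc_ceiling_gap_N_four {h : ℤ} {C : MConfig} (hC : LSupport h C) (hG : C.G1Closed) (hD : RuleDMu4Closed C)
    (hX : XPlusClosed C) {N : MCell} (hN : N ∈ C.lower) (hFC : FCc N) {f : Fin 4} {c : ℕ} {k : Fin 4}
    (e : N f = lineLetter h c k) : 2 * (c : ℤ) + 8 ≤ h := by
  have hM := lineModel_of_config hC hG hD hX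
  obtain ⟨X, rfl⟩ := exists_realize (fun g => hC.1 _ hN g)
  have hc := charges_pos_of_fcc hFC
  rw [realize_apply] at e
  rw [← charge_eq_of_lineLetter_eq e]
  exact hM.fcN_gap_four hN hc f

/-- **no fully charged cell on any LINE design of height `< 8`** (PROVED, uniformly in `h`; `LineInertia.fc_threshold` had the
case `h = 6` by hand) and no fully charged `N`-cell below `h = 10`. -/
theorem no_fc_below_eight {h : ℤ} (hh : h < 8) {C : MConfig} (hC : LSupport h C) (hG : C.G1Closed) (hD : RuleDMu4Closed C)
    (hX : XPlusClosed C) {Z : MCell} (hZ : Z ∈ C.lower ∪ C.upper) : ¬ FCc Z := by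
  intro hFC
  have hM := lineModel_of_config hC hG hD hX
  rcases Finset.mem_union.mp hZ with h1 | h1
  · obtain ⟨X, rfl⟩ := exists_realize (fun g => hC.1 _ h1 g)
    have hc := charges_pos_of_fcc hFC
    have key := hM.fcN_gap_four h1 hc 0
    have : (1 : ℤ) ≤ (X 0).1 := by exact_mod_cast hc 0
    linarith
  · obtain ⟨X, rfl⟩ := exists_realize (fun g => hC.2 _ h1 g)
    have hc := charges_pos_of_fcc hFC
    have key := hM.fcP_gap_three h1 hc 0
    have : (1 : ℤ) ≤ (X 0).1 := by exact_mod_cast hc 0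
    linarith

/-- `no_fcN_below_ten` (Part F; tree copy, statement verbatim). -/
theorem no_fcN_below_ten {h : ℤ} (hh : h < 10) {C : MConfig} (hC : LSupport h C) (hG : C.G1Closed) (hD : RuleDMu4Closed C)
    (hX : XPlusClosed C) {N : MCell} (hN : N ∈ C.lower) : ¬ FCc N := by
  intro hFC
  obtain ⟨X, rfl⟩ := exists_realize (fun g => hC.1 _ hN g)
  have hc := charges_pos_of_fcc hFC
  have key := (lineModel_of_config hC hG hD hX).fcN_gap_four hN hc 0
  have : (1 : ℤ) ≤ (X 0).1 := by exact_mod_cast hc 0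
  linarith

/-- hence (PROVED, no machine input) **`OddFCFreeLine h` for every `h < 8`**; the machine check is needed only at `h ∈ {8,…,11}`. -/
theorem oddFCFreeLine_of_lt_eight {h : ℤ} (hh : h < 8) : OddFCFreeLine h := by
  intro C hC hG hD hX hodd
  rcases hodd with ⟨Z, hZ, hFC, -⟩ | ⟨P, hP, hFC, -⟩
  · exact no_fc_below_eight hh hC hG hD hX (Finset.mem_union_left _ hZ) hFC
  · exact no_fc_below_eight hh hC hG hD hX (Finset.mem_union_right _ hP) hFC

/-- the sharp BOTTOM NUCLEUS of the odd-freeness check: odd cells with `2(c+4) ≤ h` on `N`, `2(c+3) ≤ h` on `P` (at `h = 10`: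
charges `= 1` on `N`, `≤ 2` on `P` — the 44 orbits `uplocal.py` found to need search). -/
def AbstractOddSharpNucleusFree (h : ℤ) : Prop :=
  ∀ vN vP : ACell → Prop, LineModel h vN vP → ∀ X : ACell, AOddFC X →
    ((∀ f, 2 * ((X f).1 : ℤ) + 8 ≤ h) → ¬ vN X) ∧ ((∀ f, 2 * ((X f).1 : ℤ) + 6 ≤ h) → ¬ vP X)

/-- REDUCTION (PROVED): the sharp nucleus check implies the full finite check. -/
theorem abstractOddFree_of_sharpNucleus {h : ℤ} (hN : AbstractOddSharpNucleusFree h) : AbstractOddFree h := by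
  intro vN vP M X hX
  refine ⟨fun hv => (hN vN vP M X hX).1 (fun f => M.fcN_gap_four hv hX.1 f) hv,
    fun hv => (hN vN vP M X hX).2 (fun f => M.fcP_gap_three hv hX.1 f) hv⟩

end Summit.Ventures.HSemireg.Pad4Tower.LinePhaseRigidity
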